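import Summits.ValiantsHypothesis.ValiantsHypothesis.Theorems.KPlusLogSqLawTropicalBMarkedEdgeFourBitLaw
import Summits.ValiantsHypothesis.ValiantsHypothesis.Theorems.MatrixDescartes.Negative.MatrixDescartesFalseOfTropicalMonster

/-!
# Route «KPlusLogSqLaw», crux `TropicalB` (stmt-ValiantsHypothesis-19771) — MARKED-EDGE sector, FOUR-BIT LAW, part 5:
# the law in the tree's currency (`IsDominant` / `termSign` / `tropWeight` of dominance designs)

HONEST FRAMING.  Helper file (cell `pub-symmetroid`, seat val-sym-trop-p4 (g16), 2026-08-28; `--supports stmt-ValiantsHypothesis-19771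
--as helper`).  Last file of the kernel version of the lineage's «MARKED-EDGE FOUR-BIT LAW» (g15 THEOREM-FOURBIT.md): the abstract
`four_bit_law` of part 4 read for DOMINANCE DESIGNS `(d, v, ε)` of the cell (`…MatrixDescartesFalseOfTropicalMonster`: a term is a pair
(permutation, class map); `IsDominant d v ε θ p` = the term is present and every other present term has strictly smaller `tropWeight` at
the integer slope `θ`).  A structure theorem of one sector of designs; nothing here concerns general designs, `TropicalB` in its window,
`WeakLifting`, the doors, `MatrixDescartes` (stmt-ValiantsHypothesis-18050) or VP ≠ VNP.

* `four_bit_law_static` — STATIC designs (every present cell `(i, j)` carries one class `cl i j`) whose present OFF-DIAGONAL cells have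
  exponent `0` (the diagonal cells are the «marked loops», of exponents `d (cl i i)`): for four diagonal cells `b₀, b₁, b₂, b₃` with
  exponents `e₀ < e₁ < e₂`, `e₁ + e₂ < e₃`, and every other diagonal cell of non-zero exponent used alike by the four terms, NO four
  dominant terms have the fixed-point patterns «`b₀,b₁,b₂` not `b₃`», «`b₀,b₃` not `b₁,b₂`», «`b₁,b₃` not `b₀,b₂`», «`b₂,b₃` not `b₀,b₁`»
  (any size `m`, any number of classes, any valuations and support, any four slopes `θ`).
* `markedEdge_four_bit_law` — the lineage's MARKED-EDGE SECTOR verbatim (format `(m, 5)`, `d = (0, 1, 2, 4, 8)`, class `l + 1` only on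
  the diagonal cell `(l, l)` for `l < 4`, class `0` only elsewhere, ANY support and valuations, EVERY `m ≥ 4`): the patterns
  `{0,1,2}, {0,3}, {1,3}, {2,3}` of used marked loops are never simultaneously dominant.  COROLLARY (THEOREM-FOURBIT.md Cor. 1): no full
  4-bit marked-edge counter exists on any number of nodes (with p619172 / p629712: `m_min(2) = 3`, `m_min(3) = 5`, `m_min(4) = ∞`).
-/

set_option linter.dupNamespace false
set_option autoImplicit false

namespace Summit.ValiantsHypothesis.ValiantsHypothesis.Theorems.KPlusLogSqLaw
namespace MarkedEdge
namespace FourBit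

open Finset
open Summit.ValiantsHypothesis.ValiantsHypothesis.Theorems.MatrixDescartes.Negative

variable {m K : ℕ}

/-- In a static design a present term uses, on each of its cells, THE class of that cell. [folklore] -/
theorem classes_of_termSign_ne_zero (ε : Fin m → Fin m → Fin K → ℤ) (cl : Fin m → Fin m → Fin K)
    (hstatic : ∀ i j l, ε i j l ≠ 0 → l = cl i j) (p : Equiv.Perm (Fin m) × (Fin m → Fin K)) (hp : termSign ε p ≠ 0) :
    (∀ i, p.2 i = cl (p.1 i) i) ∧ ∀ i, ε (p.1 i) i (cl (p.1 i) i) ≠ 0 := by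
  unfold termSign at hp
  have hprod : ∀ i, ε (p.1 i) i (p.2 i) ≠ 0 := fun i h =>
    hp (by rw [Finset.prod_eq_zero (Finset.mem_univ i) h, mul_zero])
  refine ⟨fun i => hstatic _ _ _ (hprod i), fun i => ?_⟩
  rw [← hstatic _ _ _ (hprod i)]
  exact hprod i

/-- The canonical term of a cover whose cells are present is present. [folklore] -/
theorem termSign_canonical_ne_zero (ε : Fin m → Fin m → Fin K → ℤ) (cl : Fin m → Fin m → Fin K) (σ : Equiv.Perm (Fin m))
    (hok : ∀ i, ε (σ i) i (cl (σ i) i) ≠ 0) :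
    termSign ε ((σ, fun i => cl (σ i) i) : Equiv.Perm (Fin m) × (Fin m → Fin K)) ≠ 0 := by
  unfold termSign
  exact mul_ne_zero (Units.ne_zero _) (Finset.prod_ne_zero_iff.2 fun i _ => hok i)

/-- Tropical weight of a canonical term in weight/loop-slope form, when present off-diagonal cells have exponent `0`. [folklore] -/
theorem tropWeight_canonical (d : Fin K → ℕ) (v ε : Fin m → Fin m → Fin K → ℤ) (cl : Fin m → Fin m → Fin K)
    (hoffd : ∀ i j, i ≠ j → ε i j (cl i j) ≠ 0 → d (cl i j) = 0) (θ : ℤ) (σ : Equiv.Perm (Fin m))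
    (hok : ∀ i, ε (σ i) i (cl (σ i) i) ≠ 0) :
    tropWeight d v θ ((σ, fun i => cl (σ i) i) : Equiv.Perm (Fin m) × (Fin m → Fin K))
      = ∑ i, (-v (σ i) i (cl (σ i) i) + θ * (if σ i = i then (d (cl i i) : ℤ) else 0)) := by
  have hpt : ∀ i, (if σ i = i then (d (cl i i) : ℤ) else 0) = (d (cl (σ i) i) : ℤ) := by
    intro i
    split_ifs with h
    · rw [h]
    · rw [hoffd (σ i) i h (hok i)]; simp
  unfold tropWeight
  simp only [hpt]
  rw [Finset.sum_add_distrib, ← Finset.mul_sum, Finset.sum_neg_distrib]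
  ring

/-- **Bridge.**  A dominant term of such a static design is, read as a cover, the unique maximiser of the abstract score of part 3
(arc presence = cell present, arc weight = minus the valuation of the cell's class, loop slope = exponent of the diagonal class).
[this seat's lemma] -/
theorem isMax_of_isDominant (d : Fin K → ℕ) (v ε : Fin m → Fin m → Fin K → ℤ) (cl : Fin m → Fin m → Fin K)
    (hstatic : ∀ i j l, ε i j l ≠ 0 → l = cl i j) (hoffd : ∀ i j, i ≠ j → ε i j (cl i j) ≠ 0 → d (cl i j) = 0)
    {θ : ℤ} {p : Equiv.Perm (Fin m) × (Fin m → Fin K)} (hp : IsDominant d v ε θ p) :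
    (∀ i, ε (p.1 i) i (cl (p.1 i) i) ≠ 0) ∧ ∀ τ : Equiv.Perm (Fin m), τ ≠ p.1 → (∀ i, ε (τ i) i (cl (τ i) i) ≠ 0) →
      ∑ i, (-v (τ i) i (cl (τ i) i) + θ * (if τ i = i then (d (cl i i) : ℤ) else 0))
        < ∑ i, (-v (p.1 i) i (cl (p.1 i) i) + θ * (if p.1 i = i then (d (cl i i) : ℤ) else 0)) := by
  obtain ⟨hcl, hok⟩ := classes_of_termSign_ne_zero ε cl hstatic p hp.1
  refine ⟨hok, fun τ hτ hokτ => ?_⟩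
  have hp2 : p = ((p.1, fun i => cl (p.1 i) i) : Equiv.Perm (Fin m) × (Fin m → Fin K)) := Prod.ext rfl (funext hcl)
  have hne : ((τ, fun i => cl (τ i) i) : Equiv.Perm (Fin m) × (Fin m → Fin K)) ≠ p := fun h => hτ (by rw [← h])
  have hlt := hp.2 _ hne (termSign_canonical_ne_zero ε cl τ hokτ)
  have e2 : tropWeight d v θ p = tropWeight d v θ ((p.1, fun i => cl (p.1 i) i) : Equiv.Perm (Fin m) × (Fin m → Fin K)) := by
    rw [← hp2]
  rw [e2, tropWeight_canonical d v ε cl hoffd θ τ hokτ, tropWeight_canonical d v ε cl hoffd θ p.1 hok] at hlt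
  exact hlt

/-- **THE MARKED-EDGE FOUR-BIT LAW for static dominance designs** (tree currency).  Static design (`hstatic`: a present class on cell
`(i, j)` is `cl i j`), present off-diagonal cells of exponent `0` (`hoffd`), four diagonal cells `b₀, b₁, b₂, b₃` with exponents
`e₀ < e₁ < e₂`, `e₁ + e₂ < e₃`, every other diagonal cell of non-zero exponent used alike by the four terms (`hctx`).  Then no four terms,
dominant at four integer slopes, have the fixed-point patterns «`b₀,b₁,b₂` not `b₃`» / «`b₀,b₃` not `b₁,b₂`» / «`b₁,b₃` not `b₀,b₂`» /
«`b₂,b₃` not `b₀,b₁`».  (Every size `m`, every number of classes `K`; no order of the slopes assumed.)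
[this seat's theorem; kernel version of THEOREM-FOURBIT.md §1 (general form) in the cell's `IsDominant` vocabulary] -/
theorem four_bit_law_static (d : Fin K → ℕ) (v ε : Fin m → Fin m → Fin K → ℤ) (cl : Fin m → Fin m → Fin K)
    (hstatic : ∀ i j l, ε i j l ≠ 0 → l = cl i j) (hoffd : ∀ i j, i ≠ j → ε i j (cl i j) ≠ 0 → d (cl i j) = 0)
    {b₀ b₁ b₂ b₃ : Fin m} (hs01 : d (cl b₀ b₀) < d (cl b₁ b₁)) (hs12 : d (cl b₁ b₁) < d (cl b₂ b₂))
    (hs3 : d (cl b₁ b₁) + d (cl b₂ b₂) < d (cl b₃ b₃))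
    {θD θA θB θC : ℤ} {pD pA pB pC : Equiv.Perm (Fin m) × (Fin m → Fin K)}
    (hD : IsDominant d v ε θD pD) (hA : IsDominant d v ε θA pA) (hB : IsDominant d v ε θB pB) (hC : IsDominant d v ε θC pC)
    (hD0 : pD.1 b₀ = b₀) (hD1 : pD.1 b₁ = b₁) (hD2 : pD.1 b₂ = b₂) (hD3 : pD.1 b₃ ≠ b₃)
    (hA0 : pA.1 b₀ = b₀) (hA1 : pA.1 b₁ ≠ b₁) (hA2 : pA.1 b₂ ≠ b₂) (hA3 : pA.1 b₃ = b₃)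
    (hB0 : pB.1 b₀ ≠ b₀) (hB1 : pB.1 b₁ = b₁) (hB2 : pB.1 b₂ ≠ b₂) (hB3 : pB.1 b₃ = b₃)
    (hC0 : pC.1 b₀ ≠ b₀) (hC1 : pC.1 b₁ ≠ b₁) (hC2 : pC.1 b₂ = b₂) (hC3 : pC.1 b₃ = b₃)
    (hctx : ∀ i, i ≠ b₀ → i ≠ b₁ → i ≠ b₂ → i ≠ b₃ → d (cl i i) ≠ 0 →
      (pA.1 i = i ↔ pD.1 i = i) ∧ (pB.1 i = i ↔ pD.1 i = i) ∧ (pC.1 i = i ↔ pD.1 i = i)) : False := by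
  have hg : ∀ i : Fin m, (if i = i then (d (cl i i) : ℤ) else 0) = d (cl i i) := fun i => if_pos rfl
  refine four_bit_law (V := Fin m) (fun i j => ε j i (cl j i) ≠ 0) (fun i j => -v j i (cl j i))
    (fun i j => if j = i then (d (cl i i) : ℤ) else 0) (fun i j h => if_neg h) (fun i => by rw [hg]; positivity)
    (b₀ := b₀) (b₁ := b₁) (b₂ := b₂) (b₃ := b₃) (by rw [hg, hg]; exact_mod_cast hs01) (by rw [hg, hg]; exact_mod_cast hs12)
    (by rw [hg, hg, hg]; exact_mod_cast hs3)
    hD0 hD1 hD2 hD3 hA0 hA1 hA2 hA3 hB0 hB1 hB2 hB3 hC0 hC1 hC2 hC3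
    (fun i n0 n1 n2 n3 hgi => hctx i n0 n1 n2 n3 (by rw [hg] at hgi; exact_mod_cast hgi))
    (isMax_of_isDominant d v ε cl hstatic hoffd hD) (isMax_of_isDominant d v ε cl hstatic hoffd hA)
    (isMax_of_isDominant d v ε cl hstatic hoffd hB) (isMax_of_isDominant d v ε cl hstatic hoffd hC)

/-- **THE MARKED-EDGE FOUR-BIT LAW in the lineage's sector** (format `(m, 5)`, exponents `d = (0, 1, 2, 4, 8)`; a present class on
cell `(i, j)` is class `i + 1` if `i = j < 4` (the four MARKED LOOPS, slopes `1, 2, 4, 8`) and class `0` otherwise; ANY support, ANY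
valuations, EVERY size `m ≥ 4`, i.e. any number `m - 4` of auxiliary nodes).  There are no four terms, dominant at four integer slopes,
whose sets of used marked loops are `{0,1,2}` (slope 7), `{0,3}` (9), `{1,3}` (10), `{2,3}` (12).  Hence (THEOREM-FOURBIT.md Cor. 1) NO
FULL 4-BIT MARKED-EDGE COUNTER EXISTS ON ANY NUMBER OF NODES: with `markedEdge_five_three_counter` (p619172) and
`FourThree.no_dominant_counter_four_three` (p629712), `m_min(2) = 3`, `m_min(3) = 5`, `m_min(4) = ∞`.
[this seat's theorem; kernel version of THEOREM-FOURBIT.md §1 Theorem + Cor. 1] -/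
theorem markedEdge_four_bit_law (m : ℕ) (hm : 4 ≤ m) (d : Fin 5 → ℕ)
    (hd : ∀ l : Fin 5, d l = if (l : ℕ) = 0 then 0 else 2 ^ ((l : ℕ) - 1)) (v ε : Fin m → Fin m → Fin 5 → ℤ)
    (hsec : ∀ (i j : Fin m) (l : Fin 5), ε i j l ≠ 0 → (l : ℕ) = if i = j ∧ (i : ℕ) < 4 then (i : ℕ) + 1 else 0) :
    ¬ ∃ (θ : Fin 4 → ℤ) (p : Fin 4 → Equiv.Perm (Fin m) × (Fin m → Fin 5)),
      (∀ k, IsDominant d v ε (θ k) (p k)) ∧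
      ∀ n : Fin m, (n : ℕ) < 4 →
        ((p 0).1 n = n ↔ (n : ℕ) ≠ 3) ∧ ((p 1).1 n = n ↔ ((n : ℕ) = 0 ∨ (n : ℕ) = 3)) ∧
        ((p 2).1 n = n ↔ ((n : ℕ) = 1 ∨ (n : ℕ) = 3)) ∧ ((p 3).1 n = n ↔ ((n : ℕ) = 2 ∨ (n : ℕ) = 3)) := by
  rintro ⟨θ, p, hdom, hpat⟩
  -- the class of a cell
  let cl : Fin m → Fin m → Fin 5 := fun i j => if h : i = j ∧ (i : ℕ) < 4 then ⟨(i : ℕ) + 1, by omega⟩ else 0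
  have hclval : ∀ i j : Fin m, ((cl i j : Fin 5) : ℕ) = if i = j ∧ (i : ℕ) < 4 then (i : ℕ) + 1 else 0 := by
    intro i j
    by_cases h : i = j ∧ (i : ℕ) < 4
    · simp only [cl, dif_pos h, if_pos h]
    · simp only [cl, dif_neg h, if_neg h, Fin.val_zero]
  have hstatic : ∀ i j l, ε i j l ≠ 0 → l = cl i j := fun i j l h => Fin.ext (by rw [hsec i j l h, hclval])
  have hoffd : ∀ i j : Fin m, i ≠ j → ε i j (cl i j) ≠ 0 → d (cl i j) = 0 := by
    intro i j hij _
    have : cl i j = 0 := dif_neg (show ¬ (i = j ∧ (i : ℕ) < 4) from fun h => hij h.1)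
    rw [this, hd]; rfl
  -- the four marked nodes and their exponents
  let n₀ : Fin m := ⟨0, by omega⟩
  let n₁ : Fin m := ⟨1, by omega⟩
  let n₂ : Fin m := ⟨2, by omega⟩
  let n₃ : Fin m := ⟨3, by omega⟩
  have hdiag : ∀ (i : Fin m) (hi : (i : ℕ) < 4), d (cl i i) = 2 ^ (i : ℕ) := by
    intro i hi
    have : cl i i = ⟨(i : ℕ) + 1, by omega⟩ := by simp only [cl, dif_pos (And.intro rfl hi)]
    rw [this, hd]
    simp
  have e0 : d (cl n₀ n₀) = 1 := hdiag n₀ (by simp [n₀])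
  have e1 : d (cl n₁ n₁) = 2 := hdiag n₁ (by simp [n₁])
  have e2 : d (cl n₂ n₂) = 4 := hdiag n₂ (by simp [n₂])
  have e3 : d (cl n₃ n₃) = 8 := hdiag n₃ (by simp [n₃])
  -- patterns
  obtain ⟨q00, q10, q20, q30⟩ := hpat n₀ (by simp [n₀])
  obtain ⟨q01, q11, q21, q31⟩ := hpat n₁ (by simp [n₁])
  obtain ⟨q02, q12, q22, q32⟩ := hpat n₂ (by simp [n₂])
  obtain ⟨q03, q13, q23, q33⟩ := hpat n₃ (by simp [n₃])
  simp only [n₀, n₁, n₂, n₃] at q00 q10 q20 q30 q01 q11 q21 q31 q02 q12 q22 q32 q03 q13 q23 q33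
  norm_num at q00 q10 q20 q30 q01 q11 q21 q31 q02 q12 q22 q32 q03 q13 q23 q33
  refine four_bit_law_static d v ε cl hstatic hoffd (b₀ := n₀) (b₁ := n₁) (b₂ := n₂) (b₃ := n₃)
    (by rw [e0, e1]; norm_num) (by rw [e1, e2]; norm_num) (by rw [e1, e2, e3]; norm_num)
    (hdom 0) (hdom 1) (hdom 2) (hdom 3)
    q00 q01 q02 q03 q10 q11 q12 q13 q20 q21 q22 q23 q30 q31 q32 q33 ?_
  -- context: every other diagonal cell carries class 0, exponent 0
  intro i h0 h1 h2 h3 hdi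
  exfalso
  apply hdi
  have hi4 : ¬ (i : ℕ) < 4 := by
    intro hlt
    have : (i : ℕ) = 0 ∨ (i : ℕ) = 1 ∨ (i : ℕ) = 2 ∨ (i : ℕ) = 3 := by omega
    rcases this with h | h | h | h
    · exact h0 (Fin.ext h)
    · exact h1 (Fin.ext h)
    · exact h2 (Fin.ext h)
    · exact h3 (Fin.ext h)
  have : cl i i = 0 := dif_neg (show ¬ (i = i ∧ (i : ℕ) < 4) from fun h => hi4 h.2)
  rw [this, hd]; rfl

end FourBit
end MarkedEdge
end Summit.ValiantsHypothesis.ValiantsHypothesis.Theorems.KPlusLogSqLaw
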